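/-
Origin: expansion seat `planner-pub-hodgecm-pv05-0`, handover 2026-08-18T04:07:52Z (`HOME/pub-hodgecm-pv05/lean/Pv05/DoublingTheta.lean`, md5 1b7c80c4, 94 lines);
landed by the gen-5 packager in gate run 21 as `HodgeCM/PerL34/DoublingTheta.lean` (verbatim).
-/
/-
pub-hodgecm speedrun cell, prover pv05 — WIP module `Pv05.DoublingTheta` (proposed landing place
`HodgeCM/PerL34/DoublingTheta.lean`).  Imports: the LANDED `HodgeCM.PerL34.Doubling` (pv05, run 18) and the LANDED
Literature shell `HodgeCM.Literature.ThetaCorrespondence` (cf-kudla-howe-rallis, run 19; its §7 `DoublingDatum` /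
`DoublingRestriction` / `basicIdentity` are unchanged in the v2 handed over 04:03:21Z).  Nothing posited, nothing cited.

# BY-NAME seam: the PerL34 doubling datum IS an instance of the Literature doubling shell [GQT14 §11.3]

Three seats typed the doubling see-saw restriction independently: pv05 (`PerL34.Doubling.DoublingDatum`, fields
`equivariant` PRINT-DERIVED + `ev0_δ` PRINT), pv11 (`PerL34.EqBasic.eq_basic`, unbundled binders), cf-KHR
(`Literature.Theta.DoublingDatum.DoublingRestriction`, the print statement typed "WEAKER than print").  pv05's
`DoublingBridge` (run 20) already identifies pv05 ↔ pv11 by name.  This file identifies pv05 ↔ cf-KHR by name: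

* `D.toTheta : Literature.Theta.DoublingDatum` — forget the group structure / unitarity (`G := U(W_i)(𝔸)`,
  `ωsq g₁ g₂ := ω^□(ι(g₁,g₂))`, `χVdet := χ_V` since `det = id` on `U(W_i) = U(1)`);
* `D.toTheta_doublingRestriction : D.toTheta.DoublingRestriction` — PROVED from the two N31b fields, so the
  Literature shell's print Prop is exactly what N31b posits (same orientation `δ(φ₁ ⊗ φ̄₂)(0) = ⟨φ₁,φ₂⟩ = ⟪φ₂,φ₁⟫_ℂ`);
* `D.eq_basic_via_theta` — cf-KHR's kernel theorem `basicIdentity` applied to `D.toTheta` re-derives PerL (eq:basic)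
  l. 566 for `f_Φ`, literally the statement of pv11's `eq_basic` / pv05's `DoublingBridge` (consistency of the three
  formalisations, checked by the kernel rather than by eye).
-/
import Summits.HodgeConjecture.HodgeCM.PerL34.Doubling_2
import Summits.HodgeConjecture.HodgeCM.Literature.ThetaCorrespondence_4

/-! PORT of `HodgeCM/PerL34/DoublingTheta.lean` (HodgeCMPerL run 81) — verbatim mechanical port; provenance in the PORT header line. -/

set_option autoImplicit false

noncomputable section

open scoped InnerProductSpace

universe u

namespace HodgeCM
namespace PerL34
namespace Doubling
namespace DoublingDatum

variable {A H S Sbox : Type u} [CommGroup A] [Group H]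
  [NormedAddCommGroup S] [InnerProductSpace ℂ S] [AddCommGroup Sbox] [Module ℂ Sbox]
  (D : DoublingDatum A H S Sbox)

/-- The Literature-shell doubling datum [GQT14, §11.3] underlying the PerL34 doubling datum of the line `W_i`. -/
def toTheta : HodgeCM.Literature.Theta.DoublingDatum.{u} where
  G := A
  S := S
  Ssq := Sbox
  ω g := (D.ω g).toLinearEquiv.toLinearMap
  ωsq g₁ g₂ := (D.ωbox (D.ι (g₁, g₂))).toLinearMap
  χVdet g := D.χV g
  ev0 := D.ev0
  δ φ₁ φ₂ := D.δ φ₁ φ₂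

/-- (Ported verbatim from the HodgeCMPerL package; no docstring in the source.) -/
@[simp] theorem toTheta_ω_apply (g : A) (φ : S) : D.toTheta.ω g φ = D.ω g φ := rfl

/-- (Ported verbatim from the HodgeCMPerL package; no docstring in the source.) -/
@[simp] theorem toTheta_ωsq_apply (g₁ g₂ : A) (Ψ : Sbox) :
    D.toTheta.ωsq g₁ g₂ Ψ = D.ωbox (D.ι (g₁, g₂)) Ψ := rfl

/-- (Ported verbatim from the HodgeCMPerL package; no docstring in the source.) -/
@[simp] theorem toTheta_χVdet (g : A) : D.toTheta.χVdet g = D.χV g := rfl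

/-- (Ported verbatim from the HodgeCMPerL package; no docstring in the source.) -/
@[simp] theorem toTheta_ev0 : D.toTheta.ev0 = D.ev0 := rfl

/-- (Ported verbatim from the HodgeCMPerL package; no docstring in the source.) -/
@[simp] theorem toTheta_δ (φ₁ φ₂ : S) : D.toTheta.δ φ₁ φ₂ = D.δ φ₁ φ₂ := rfl

/-- **The Literature print Prop `DoublingRestriction` [GQT14 §11.3, two closing displays] HOLDS for the PerL34
datum** — it is exactly the pair of N31b fields (`equivariant`, `ev0_δ`). -/
theorem toTheta_doublingRestriction : D.toTheta.DoublingRestriction := by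
  refine ⟨fun g₁ g₂ φ₁ φ₂ => ?_, fun φ₁ φ₂ => ?_⟩
  · show D.ωbox (D.ι (g₁, g₂)) (D.δ φ₁ φ₂) = D.χV g₂ • D.δ (D.ω g₁ φ₁) (D.ω g₂ φ₂)
    exact D.equivariant g₁ g₂ φ₁ φ₂
  · show D.ev0 (D.δ φ₁ φ₂) = ⟪φ₂, φ₁⟫_ℂ
    rw [D.ev0_δ, pair_def]
    rfl

/-- Conversely the two N31b fields are recovered from `DoublingRestriction` of `D.toTheta` (so the PerL34 posit and
the Literature print Prop are the SAME statement about the underlying data). -/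
theorem equivariant_iff_toTheta :
    D.toTheta.DoublingRestriction ↔
      (∀ (h₁ h₂ : A) (φ₁ φ₂ : S), D.ωbox (D.ι (h₁, h₂)) (D.δ φ₁ φ₂) = D.χV h₂ • D.δ (D.ω h₁ φ₁) (D.ω h₂ φ₂)) ∧
      ∀ φ₁ φ₂ : S, D.ev0 (D.δ φ₁ φ₂) = pair φ₁ φ₂ :=
  Iff.rfl

/-- **PerL (eq:basic), l. 566, via the Literature shell:** cf-KHR's kernel theorem `basicIdentity` applied to
`D.toTheta` gives `f_Φ(ι(g₁,g₂)) = χ_V(g₂) · ⟪ω(g₂)φ, ω(g₁)φ⟫_ℂ` (= `χ_V(g₂) ⟨ω(g₁)φ, ω(g₂)φ⟩` in print orientation),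
literally pv11's `EqBasic.eq_basic` conclusion for the bundled datum. -/
theorem eq_basic_via_theta (g₁ g₂ : A) (φ : S) :
    D.fSW (D.Φ φ) (D.ι (g₁, g₂)) = D.χV g₂ * ⟪D.ω g₂ φ, D.ω g₁ φ⟫_ℂ :=
  D.toTheta_doublingRestriction.basicIdentity g₁ g₂ φ

end DoublingDatum
end Doubling
end PerL34
end HodgeCM

end
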